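import Mathlib
import Literature.Probability.LatticeModels.GKSInequalities
import Summits.CriticalPhenomena.Ising3DConformalLimit.Theorems.PrecisionLaplacianInverseMFerromagnetDbDeg2Eq
import Summits.CriticalPhenomena.Ising3DConformalLimit.Theorems.PrecisionLaplacianInverseMFerromagnetImNonadjOfLaw2Aux2
import Summits.CriticalPhenomena.Ising3DConformalLimit.Theorems.PrecisionLaplacianInverseMFerromagnetMarginalTwoSep
import HarnessLib

/-!
# Crux `PrecisionLaplacian.InverseMFerromagnet` (stmt-CriticalPhenomena-4798), line `Sketch` —
# auxiliary lemmas (part 1, structure-free) for stub `helper_sp_subdivide` (T-SP·3, series step)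

THEOREM-ONLY helper file (no definitions).  General facts used by the subdivision step of the
series–parallel induction:

* `spSub_pair_sum_tanh`: `∑_ω σ_xσ_y e^{c σ_xσ_y} = tanh c · ∑_ω e^{c σ_xσ_y}` (a pure multi-bond
  pair has correlation `tanh` of its total coupling);
* `spSub_cosh_two_spins`: `cosh (u s + w t) = cosh (u+w) e^{-K''} e^{K'' s t}` on `{±1}²` with the
  SERIES COUPLING `K'' = ½ log (cosh (u+w) / cosh (u−w))` (`tanh K'' = tanh u tanh w`), and
  `K'' ≥ 0` for `u, w ≥ 0` (`spSub_series_nonneg`); `½ log ((1+r)/(1−r)) ≥ 0` for `0 ≤ r < 1`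
  (`spSub_artanh_nonneg`);
* `spSub_triangle_corr`: in a pair system all of whose bonds are `{x,y}`, `{x,z}` or `{z,y}`
  (total couplings `κ, u, w`), `⟨σ_xσ_y⟩ = tanh (κ + K''(u, w))` (sum out `σ_z`, `c2_integrate`);
* `spSub_db_deg2_eq_gen`: `helper_db_deg2_eq` for an arbitrary finite bond index type;
* `spSub_inv_two`: the off-diagonal entry `−ρ/(1−ρ²)` of the inverse of the `{c₁,c₂}`-block
  `[[1,ρ],[ρ,1]]`;
* `spSub_inv_entry_block`: entries of `N⁻¹` inside `S` are those of `(N_SS)⁻¹` when the rows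
  outside `S` are free (`c2_block`).
-/

namespace Summit.CriticalPhenomena.Ising3DConformalLimit.Cruxes.InverseMFerromagnet.PartialCovarianceLadder

open Literature.Probability.LatticeModels Finset Matrix

/-! ## Scalar and one-pair identities -/

/-- A pure (multi-)bond pair: `∑_ω σ_xσ_y e^{c σ_xσ_y} = tanh c · ∑_ω e^{c σ_xσ_y}` (`x ≠ y`), since
`e^{cs} = cosh c + s sinh c` on `s = ±1` and `∑_ω σ_xσ_y = 0`. [folklore] -/
theorem spSub_pair_sum_tanh {N : ℕ} {x y : Fin N} (hxy : x ≠ y) (F : ℝ → ℝ) :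
    ∑ ω : SpinConfig (Fin N), spinAt x ω * spinAt y ω * F (spinAt x ω * spinAt y ω)
        = (F 1 - F (-1)) / 2 * (Fintype.card (SpinConfig (Fin N)) : ℝ) ∧
      ∑ ω : SpinConfig (Fin N), F (spinAt x ω * spinAt y ω)
        = (F 1 + F (-1)) / 2 * (Fintype.card (SpinConfig (Fin N)) : ℝ) := by
  have hu : ∀ ω : SpinConfig (Fin N),
      spinAt x ω * spinAt y ω = 1 ∨ spinAt x ω * spinAt y ω = -1 := by
    intro ω
    rcases spinAt_eq_one_or_eq_neg_one x ω with h | h <;>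
      rcases spinAt_eq_one_or_eq_neg_one y ω with h' | h' <;> simp [h, h']
  have h0 : ∑ ω : SpinConfig (Fin N), spinAt x ω * spinAt y ω = 0 := marg_sum_pair_zero hxy
  -- on `s = ±1`: `F s = (F 1 + F(-1))/2 + s (F 1 - F (-1))/2`
  have hF : ∀ ω : SpinConfig (Fin N), F (spinAt x ω * spinAt y ω)
      = (F 1 + F (-1)) / 2 + spinAt x ω * spinAt y ω * ((F 1 - F (-1)) / 2) := by
    intro ω
    rcases hu ω with h | h <;> rw [h] <;> ring
  have hsF : ∀ ω : SpinConfig (Fin N), spinAt x ω * spinAt y ω * F (spinAt x ω * spinAt y ω)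
      = (F 1 - F (-1)) / 2 + spinAt x ω * spinAt y ω * ((F 1 + F (-1)) / 2) := by
    intro ω
    rcases hu ω with h | h <;> rw [h] <;> ring
  constructor
  · rw [Finset.sum_congr rfl (fun ω _ => hsF ω), Finset.sum_add_distrib, ← Finset.sum_mul, h0,
      zero_mul, add_zero, Finset.sum_const, Finset.card_univ, nsmul_eq_mul, mul_comm]
  · rw [Finset.sum_congr rfl (fun ω _ => hF ω), Finset.sum_add_distrib, ← Finset.sum_mul, h0,
      zero_mul, add_zero, Finset.sum_const, Finset.card_univ, nsmul_eq_mul, mul_comm]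

/-- `(e^{c} - e^{-c}) / (e^{c} + e^{-c}) = tanh c`, in the form used with `spSub_pair_sum_tanh`.
[folklore] -/
theorem spSub_exp_ratio_tanh (c C : ℝ) (hC : C ≠ 0) (N : ℝ) (hN : N ≠ 0) :
    (C * Real.exp (c * 1) - C * Real.exp (c * -1)) / 2 * N
      = Real.tanh c * ((C * Real.exp (c * 1) + C * Real.exp (c * -1)) / 2 * N) := by
  rw [mul_one, mul_neg_one, Real.tanh_eq_sinh_div_cosh, Real.sinh_eq, Real.cosh_eq]
  have h2 : Real.exp c + Real.exp (-c) ≠ 0 := by positivity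
  field_simp

/-- **The series coupling.**  For spins `s, t = ±1`:
`cosh (u s + w t) = cosh (u+w) · e^{-K''} · e^{K'' s t}` with `K'' = ½ log (cosh (u+w)/cosh (u−w))`
(so that `e^{2K''} = cosh (u+w)/cosh (u−w)`, i.e. `tanh K'' = tanh u · tanh w`). [folklore] -/
theorem spSub_cosh_two_spins (u w s t : ℝ) (hs : s = 1 ∨ s = -1) (ht : t = 1 ∨ t = -1) :
    Real.cosh (u * s + w * t)
      = Real.cosh (u + w) * Real.exp (-(Real.log (Real.cosh (u + w) / Real.cosh (u - w)) / 2))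
        * Real.exp (Real.log (Real.cosh (u + w) / Real.cosh (u - w)) / 2 * (s * t)) := by
  have hq : 0 < Real.cosh (u + w) / Real.cosh (u - w) := div_pos (Real.cosh_pos _) (Real.cosh_pos _)
  have e1 : Real.cosh (u + w) * Real.exp (-(Real.log (Real.cosh (u + w) / Real.cosh (u - w)) / 2))
      * Real.exp (Real.log (Real.cosh (u + w) / Real.cosh (u - w)) / 2 * 1) = Real.cosh (u + w) := by
    rw [mul_assoc, ← Real.exp_add, mul_one, neg_add_cancel, Real.exp_zero, mul_one]
  have e2 : Real.cosh (u + w) * Real.exp (-(Real.log (Real.cosh (u + w) / Real.cosh (u - w)) / 2))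
      * Real.exp (Real.log (Real.cosh (u + w) / Real.cosh (u - w)) / 2 * -1)
      = Real.cosh (u - w) := by
    rw [mul_assoc, ← Real.exp_add,
      show -(Real.log (Real.cosh (u + w) / Real.cosh (u - w)) / 2)
          + Real.log (Real.cosh (u + w) / Real.cosh (u - w)) / 2 * -1
        = -Real.log (Real.cosh (u + w) / Real.cosh (u - w)) by ring,
      Real.exp_neg, Real.exp_log hq]
    field_simp [(Real.cosh_pos (u + w)).ne', (Real.cosh_pos (u - w)).ne']
  rcases hs with rfl | rfl <;> rcases ht with rfl | rfl
  · rw [show (1 : ℝ) * 1 = 1 by ring, e1, mul_one, mul_one]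
  · rw [show (1 : ℝ) * -1 = -1 by ring, e2, mul_one, mul_neg_one, ← sub_eq_add_neg]
  · rw [show (-1 : ℝ) * 1 = -1 by ring, e2, mul_one, mul_neg_one, ← Real.cosh_neg]
    congr 1
    ring
  · rw [show (-1 : ℝ) * -1 = 1 by ring, e1, mul_neg_one, mul_neg_one, ← Real.cosh_neg]
    congr 1
    ring

/-- The series coupling is nonnegative: `½ log (cosh (u+w)/cosh (u−w)) ≥ 0` for `u, w ≥ 0`.
[folklore] -/
theorem spSub_series_nonneg {u w : ℝ} (hu : 0 ≤ u) (hw : 0 ≤ w) :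
    0 ≤ Real.log (Real.cosh (u + w) / Real.cosh (u - w)) / 2 := by
  have h1 : Real.cosh (u - w) ≤ Real.cosh (u + w) := by
    refine Real.cosh_le_cosh.2 ?_
    rw [abs_of_nonneg (by linarith : 0 ≤ u + w)]
    exact abs_sub_le_iff.2 ⟨by linarith, by linarith⟩
  have h2 : 1 ≤ Real.cosh (u + w) / Real.cosh (u - w) := (one_le_div (Real.cosh_pos _)).2 h1
  exact div_nonneg (Real.log_nonneg h2) zero_le_two

/-- `½ log ((1+r)/(1−r)) ≥ 0` for `0 ≤ r < 1`. [folklore] -/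
theorem spSub_artanh_nonneg {r : ℝ} (h0 : 0 ≤ r) (h1 : r < 1) :
    0 ≤ Real.log ((1 + r) / (1 - r)) / 2 := by
  have h2 : 1 ≤ (1 + r) / (1 - r) := (one_le_div (by linarith)).2 (by linarith)
  exact div_nonneg (Real.log_nonneg h2) zero_le_two

/-! ## The triangle: summing out the middle spin -/

/-- **Correlation across a subdivided bond in parallel with direct bonds.**  If every bond of the
pair system is `{x,y}`, `{x,z}` or `{z,y}` (total couplings `κ`, `u`, `w`), then
`⟨σ_xσ_y⟩ = tanh (κ + K'')`, `K'' = ½ log (cosh (u+w)/cosh (u−w))`: summing out `σ_z`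
(`c2_integrate`) turns the path `x – z – y` into the bond `{x,y}` of coupling `K''`.
[folklore] -/
theorem spSub_triangle_corr {N : ℕ} {ι : Type*} [Fintype ι] (K : ι → ℝ) (C : ι → Finset (Fin N))
    {x y z : Fin N} (hxy : x ≠ y) (hxz : x ≠ z) (hzy : z ≠ y)
    (h : ∀ i, C i = {x, y} ∨ C i = {x, z} ∨ C i = {z, y}) :
    gksExpect Finset.univ K C (fun ω => spinAt x ω * spinAt y ω)
      = Real.tanh ((∑ i ∈ Finset.univ.filter (fun i => C i = {x, y}), K i)
          + Real.log (Real.cosh ((∑ i ∈ Finset.univ.filter (fun i => C i = {x, z}), K i)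
                + ∑ i ∈ Finset.univ.filter (fun i => C i = {z, y}), K i)
              / Real.cosh ((∑ i ∈ Finset.univ.filter (fun i => C i = {x, z}), K i)
                - ∑ i ∈ Finset.univ.filter (fun i => C i = {z, y}), K i)) / 2) := by
  classical
  obtain ⟨κ, hκ⟩ : ∃ κ : ℝ, (∑ i ∈ Finset.univ.filter (fun i => C i = {x, y}), K i) = κ := ⟨_, rfl⟩
  obtain ⟨u, hu⟩ : ∃ u : ℝ, (∑ i ∈ Finset.univ.filter (fun i => C i = {x, z}), K i) = u := ⟨_, rfl⟩
  obtain ⟨w, hw⟩ : ∃ w : ℝ, (∑ i ∈ Finset.univ.filter (fun i => C i = {z, y}), K i) = w := ⟨_, rfl⟩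
  rw [hκ, hu, hw]
  -- the three supports are distinct
  have n12 : ({x, y} : Finset (Fin N)) ≠ {x, z} := by
    intro he
    have hm : y ∈ ({x, z} : Finset (Fin N)) := by rw [← he]; simp
    simp only [Finset.mem_insert, Finset.mem_singleton] at hm
    rcases hm with hm | hm
    · exact hxy hm.symm
    · exact hzy hm.symm
  have n13 : ({x, y} : Finset (Fin N)) ≠ {z, y} := by
    intro he
    have hm : x ∈ ({z, y} : Finset (Fin N)) := by rw [← he]; simp
    simp only [Finset.mem_insert, Finset.mem_singleton] at hm
    rcases hm with hm | hm
    · exact hxz hm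
    · exact hxy hm
  have n23 : ({x, z} : Finset (Fin N)) ≠ {z, y} := by
    intro he
    have hm : x ∈ ({z, y} : Finset (Fin N)) := by rw [← he]; simp
    simp only [Finset.mem_insert, Finset.mem_singleton] at hm
    rcases hm with hm | hm
    · exact hxz hm
    · exact hxy hm
  -- the Hamiltonian, and the Hamiltonian with the bonds at `z` switched off
  have hterm : ∀ (i : ι) (ω : SpinConfig (Fin N)), K i * spinProduct (C i) ω
      = (if C i = {x, y} then K i else 0) * (spinAt x ω * spinAt y ω)
        + (if C i = {x, z} then K i else 0) * (spinAt x ω * spinAt z ω)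
        + (if C i = {z, y} then K i else 0) * (spinAt z ω * spinAt y ω) := by
    intro i ω
    rcases h i with hi | hi | hi <;> rw [hi]
    · rw [if_pos rfl, if_neg n12, if_neg n13, c2_spinProduct_pair hxy]; ring
    · rw [if_neg n12.symm, if_pos rfl, if_neg n23, c2_spinProduct_pair hxz]; ring
    · rw [if_neg n13.symm, if_neg n23.symm, if_pos rfl, c2_spinProduct_pair hzy]; ring
  have hH : ∀ ω : SpinConfig (Fin N), gksHamiltonian Finset.univ K C ω
      = κ * (spinAt x ω * spinAt y ω)
        + spinAt z ω * (u * spinAt x ω + w * spinAt y ω) := by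
    intro ω
    unfold gksHamiltonian
    rw [Finset.sum_congr rfl (fun i _ => hterm i ω), Finset.sum_add_distrib, Finset.sum_add_distrib,
      ← Finset.sum_mul, ← Finset.sum_mul, ← Finset.sum_mul, ← Finset.sum_filter,
      ← Finset.sum_filter, ← Finset.sum_filter, hκ, hu, hw]
    ring
  obtain ⟨Kz, hKz⟩ : ∃ Kz : ι → ℝ, Kz = fun i => if z ∈ C i then 0 else K i := ⟨_, rfl⟩
  have htermz : ∀ (i : ι) (ω : SpinConfig (Fin N)), Kz i * spinProduct (C i) ω
      = (if C i = {x, y} then K i else 0) * (spinAt x ω * spinAt y ω) := by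
    intro i ω
    rw [hKz]
    dsimp only
    rcases h i with hi | hi | hi <;> rw [hi]
    · have hz : z ∉ ({x, y} : Finset (Fin N)) := by
        simp only [Finset.mem_insert, Finset.mem_singleton, not_or]
        exact ⟨hxz.symm, hzy⟩
      rw [if_neg hz, if_pos rfl, c2_spinProduct_pair hxy]
    · rw [if_pos (by simp), if_neg n12.symm]; ring
    · rw [if_pos (by simp), if_neg n13.symm]; ring
  have hHz : ∀ ω : SpinConfig (Fin N), gksHamiltonian Finset.univ Kz C ω
      = κ * (spinAt x ω * spinAt y ω) := by
    intro ω
    unfold gksHamiltonian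
    rw [Finset.sum_congr rfl (fun i _ => htermz i ω), ← Finset.sum_mul, ← Finset.sum_filter, hκ]
  have hH' : ∀ ω : SpinConfig (Fin N), gksHamiltonian Finset.univ K C ω
      = gksHamiltonian Finset.univ Kz C ω + spinAt z ω * (u * spinAt x ω + w * spinAt y ω) := by
    intro ω
    rw [hH, hHz]
  have hKz0 : ∀ i ∈ (Finset.univ : Finset ι), z ∈ C i → Kz i = 0 := fun i _ hi => by
    rw [hKz]
    dsimp only
    rw [if_pos hi]
  have hh : ∀ ω : SpinConfig (Fin N),
      u * spinAt x (ω * Pi.mulSingle z (-1)) + w * spinAt y (ω * Pi.mulSingle z (-1))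
        = u * spinAt x ω + w * spinAt y ω := fun ω => by
    rw [pcm2im_spinAt_flip_ne hxz, pcm2im_spinAt_flip_ne hzy.symm]
  -- summing out `σ_z`
  have key : ∀ F : SpinConfig (Fin N) → ℝ, (∀ ω, F (ω * Pi.mulSingle z (-1)) = F ω) →
      gksSum Finset.univ K C F
        = ∑ ω : SpinConfig (Fin N), F ω *
            (Real.cosh (u + w) * Real.exp (-(Real.log (Real.cosh (u + w) / Real.cosh (u - w)) / 2))
              * Real.exp ((κ + Real.log (Real.cosh (u + w) / Real.cosh (u - w)) / 2)
                * (spinAt x ω * spinAt y ω))) := by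
    intro F hF
    rw [(c2_integrate Finset.univ K Kz C z _ hH' hKz0 hh F hF).2]
    unfold gksSum gksWeight
    refine Finset.sum_congr rfl fun ω _ => ?_
    dsimp only
    rw [hHz, spSub_cosh_two_spins u w _ _ (spinAt_eq_one_or_eq_neg_one x ω)
      (spinAt_eq_one_or_eq_neg_one y ω), add_mul κ, Real.exp_add]
    ring
  have hZpos : (0 : ℝ) < Fintype.card (SpinConfig (Fin N)) := Nat.cast_pos.2 Fintype.card_pos
  have hCne : Real.cosh (u + w) * Real.exp (-(Real.log (Real.cosh (u + w) / Real.cosh (u - w)) / 2))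
      ≠ 0 := (mul_pos (Real.cosh_pos _) (Real.exp_pos _)).ne'
  obtain ⟨h1, h2⟩ := spSub_pair_sum_tanh hxy
    (fun s => Real.cosh (u + w) * Real.exp (-(Real.log (Real.cosh (u + w) / Real.cosh (u - w)) / 2))
      * Real.exp ((κ + Real.log (Real.cosh (u + w) / Real.cosh (u - w)) / 2) * s))
  unfold gksExpect
  rw [key _ (fun ω => by rw [pcm2im_spinAt_flip_ne hxz, pcm2im_spinAt_flip_ne hzy.symm]),
    key _ (fun _ => rfl)]
  simp only [one_mul]
  rw [h1, h2, spSub_exp_ratio_tanh _ _ hCne _ hZpos.ne', mul_div_assoc]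
  rw [div_self, mul_one]
  rw [← h2]
  exact (Finset.sum_pos (fun ω _ => mul_pos (mul_pos (Real.cosh_pos _) (Real.exp_pos _))
    (Real.exp_pos _)) Finset.univ_nonempty).ne'

/-! ## Linear algebra and re-indexing -/

/-- `helper_db_deg2_eq` for an arbitrary finite bond index type (re-index the bonds by
`Fintype.equivFin`, `c2_reindex`). [folklore] -/
theorem spSub_db_deg2_eq_gen {N : ℕ} {ι : Type*} [Fintype ι] (K : ι → ℝ) (C : ι → Finset (Fin N))
    (hK : ∀ i, 0 ≤ K i) (hC : ∀ i, (C i).card = 2) (x x' y : Fin N) (hxy : x ≠ y) (hxx' : x ≠ x')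
    (hx'y : x' ≠ y) (hb : ∀ i, x ∈ C i → (C i = {x, x'} ∨ C i = {x, y})) :
    (Matrix.of fun p q : Fin N => gksExpect Finset.univ K C (fun ω => spinAt p ω * spinAt q ω))⁻¹ x y =
      -(Real.tanh (∑ i ∈ Finset.univ.filter (fun i => C i = {x, y}), K i)) /
        (1 + Real.tanh (∑ i ∈ Finset.univ.filter (fun i => C i = {x, y}), K i) ^ 2
          - 2 * Real.tanh (∑ i ∈ Finset.univ.filter (fun i => C i = {x, y}), K i)
            * gksExpect Finset.univ K C (fun ω => spinAt x ω * spinAt y ω)) := by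
  classical
  set e := Fintype.equivFin ι
  have h := helper_db_deg2_eq N (Fintype.card ι) (K ∘ e.symm) (C ∘ e.symm) (fun j => hK _)
    (fun j => hC _) x x' y hxy hxx' hx'y (fun j hj => hb _ hj)
  have hE : ∀ f : SpinConfig (Fin N) → ℝ,
      gksExpect Finset.univ (K ∘ e.symm) (C ∘ e.symm) f = gksExpect Finset.univ K C f :=
    fun f => c2_reindex e K C f
  have hS : (∑ j ∈ Finset.univ.filter (fun j => (C ∘ e.symm) j = {x, y}), (K ∘ e.symm) j)
      = ∑ i ∈ Finset.univ.filter (fun i => C i = {x, y}), K i := by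
    rw [Finset.sum_filter, Finset.sum_filter]
    exact Equiv.sum_comp e.symm (fun i => if C i = {x, y} then K i else 0)
  simp only [hE, hS] at h
  exact h

/-- The off-diagonal entry of the inverse of the `{c₁, c₂}`-block `[[1, ρ], [ρ, 1]]` of a matrix
with unit diagonal is `−ρ/(1 − ρ²)` (`1 − ρ² ≠ 0`). [folklore] -/
theorem spSub_inv_two {N : ℕ} (G : Matrix (Fin N) (Fin N) ℝ) {c₁ c₂ : Fin N} (hne : c₁ ≠ c₂)
    (h11 : G c₁ c₁ = 1) (h22 : G c₂ c₂ = 1) (h21 : G c₂ c₁ = G c₁ c₂) (hρ : 1 - G c₁ c₂ ^ 2 ≠ 0)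
    (h1 : c₁ ∈ ({c₁, c₂} : Finset (Fin N))) (h2 : c₂ ∈ ({c₁, c₂} : Finset (Fin N))) :
    (G.submatrix (Subtype.val : ↥({c₁, c₂} : Finset (Fin N)) → Fin N)
        (Subtype.val : ↥({c₁, c₂} : Finset (Fin N)) → Fin N))⁻¹ ⟨c₁, h1⟩ ⟨c₂, h2⟩
      = -G c₁ c₂ / (1 - G c₁ c₂ ^ 2) := by
  set S : Finset (Fin N) := {c₁, c₂} with hS
  set X : Matrix ↥S ↥S ℝ := G.submatrix (Subtype.val : ↥S → Fin N) (Subtype.val : ↥S → Fin N)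
    with hX
  obtain ⟨B, hB⟩ : ∃ B : Matrix ↥S ↥S ℝ, B = Matrix.of fun p q : ↥S =>
      if p.1 = q.1 then 1 / (1 - G c₁ c₂ ^ 2) else -G c₁ c₂ / (1 - G c₁ c₂ ^ 2) := ⟨_, rfl⟩
  have hBX : B * X = 1 := by
    ext p q
    rw [Matrix.mul_apply, Matrix.one_apply]
    have hsum : ∑ r : ↥S, B p r * X r q
        = ∑ r ∈ S, (if p.1 = r then 1 / (1 - G c₁ c₂ ^ 2) else -G c₁ c₂ / (1 - G c₁ c₂ ^ 2))
            * G r q.1 := by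
      rw [← Finset.sum_coe_sort S]
      exact Finset.sum_congr rfl fun r _ => by rw [hB]; rfl
    rw [hsum, Finset.sum_pair hne]
    have hp := p.2
    have hq := q.2
    simp only [hS, Finset.mem_insert, Finset.mem_singleton] at hp hq
    have hpq : p = q ↔ p.1 = q.1 := Subtype.ext_iff
    rcases hp with hp | hp <;> rcases hq with hq | hq <;>
      simp only [hpq, hp, hq, if_true, hne, hne.symm, if_false, h11, h22, h21] <;>
      field_simp <;> ring
  rw [Matrix.inv_eq_left_inv hBX, hB, Matrix.of_apply, if_neg hne]

/-- If the rows of the positive definite `N` outside `S` are free (`N p k = 0` for `p ∉ S`,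
`k ≠ p`), the entries of `N⁻¹` inside `S` are those of `(N_SS)⁻¹` (`c2_block` with unit vectors).
[folklore] -/
theorem spSub_inv_entry_block {N : ℕ} (M : Matrix (Fin N) (Fin N) ℝ) (hM : M.PosDef)
    (S : Finset (Fin N)) (hfree : ∀ p, p ∉ S → ∀ k, k ≠ p → M p k = 0) {p q : Fin N}
    (hp : p ∈ S) (hq : q ∈ S) :
    M⁻¹ p q = (M.submatrix (Subtype.val : ↥S → Fin N) (Subtype.val : ↥S → Fin N))⁻¹
      ⟨p, hp⟩ ⟨q, hq⟩ := by
  have h := c2_block M hM S hfree (Pi.single q 1) (Pi.single p 1)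
    (fun r hr => by rw [Pi.single_eq_of_ne (ne_of_mem_of_not_mem hq hr).symm])
  rw [Matrix.mulVec_single_one, single_one_dotProduct] at h
  rw [show M⁻¹ p q = M⁻¹.col q p from rfl, h]
  -- the double sum collapses to the `(p, q)` entry
  rw [Finset.sum_eq_single ⟨p, hp⟩ (fun r _ hr => Finset.sum_eq_zero fun r' _ => by
      rw [Pi.single_eq_of_ne (fun h => hr (Subtype.ext h)), zero_mul, zero_mul])
    (fun h => absurd (Finset.mem_univ _) h),
    Finset.sum_eq_single ⟨q, hq⟩ (fun r' _ hr => by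
      rw [Pi.single_eq_of_ne (fun h => hr (Subtype.ext h)), mul_zero])
    (fun h => absurd (Finset.mem_univ _) h)]
  simp

/-- For `p ≠ q`: `{p, q} = {a, b}` forces `(p, q) = (a, b)` or `(p, q) = (b, a)`. [folklore] -/
theorem spSub_pair_eq_pair {α : Type*} [DecidableEq α] {p q a b : α} (hpq : p ≠ q)
    (h : ({p, q} : Finset α) = {a, b}) : (p = a ∧ q = b) ∨ (p = b ∧ q = a) := by
  have hp : p ∈ ({a, b} : Finset α) := by rw [← h]; simp
  have hq : q ∈ ({a, b} : Finset α) := by rw [← h]; simp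
  have ha : a ∈ ({p, q} : Finset α) := by rw [h]; simp
  have hb : b ∈ ({p, q} : Finset α) := by rw [h]; simp
  simp only [Finset.mem_insert, Finset.mem_singleton] at hp hq ha hb
  rcases hp with rfl | rfl
  · rcases hq with rfl | rfl
    · exact absurd rfl hpq
    · exact Or.inl ⟨rfl, rfl⟩
  · rcases hq with rfl | rfl
    · exact Or.inr ⟨rfl, rfl⟩
    · exact absurd rfl hpq

/-- For `p ≠ q` both in `{a, b}`: `{p, q} = {a, b}`. [folklore] -/
theorem spSub_pair_of_mem {α : Type*} [DecidableEq α] {p q a b : α} (hpq : p ≠ q)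
    (hp : p = a ∨ p = b) (hq : q = a ∨ q = b) : ({p, q} : Finset α) = {a, b} := by
  rcases hp with rfl | rfl <;> rcases hq with rfl | rfl
  · exact absurd rfl hpq
  · rfl
  · exact Finset.pair_comm _ _
  · exact absurd rfl hpq

/-- Registered helper `helper_spSub_triangle_corr` (representative of this auxiliary file): the
correlation across a subdivided bond in parallel with direct bonds, `⟨σ_xσ_y⟩ = tanh (κ + K''(u, w))`
(`spSub_triangle_corr` for `Fin`-indexed bonds). [folklore] -/
theorem helper_spSub_triangle_corr : ∀ (N m : ℕ) (K : Fin m → ℝ) (C : Fin m → Finset (Fin N)) (x y z : Fin N), x ≠ y → x ≠ z → z ≠ y → (∀ i, C i = {x, y} ∨ C i = {x, z} ∨ C i = {z, y}) → gksExpect Finset.univ K C (fun ω => spinAt x ω * spinAt y ω) = Real.tanh ((∑ i ∈ Finset.univ.filter (fun i => C i = {x, y}), K i) + Real.log (Real.cosh ((∑ i ∈ Finset.univ.filter (fun i => C i = {x, z}), K i) + ∑ i ∈ Finset.univ.filter (fun i => C i = {z, y}), K i) / Real.cosh ((∑ i ∈ Finset.univ.filter (fun i => C i = {x, z}), K i)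 - ∑ i ∈ Finset.univ.filter (fun i => C i = {z, y}), K i)) / 2) :=
  fun _ _ K C _ _ _ hxy hxz hzy h => spSub_triangle_corr K C hxy hxz hzy h

end Summit.CriticalPhenomena.Ising3DConformalLimit.Cruxes.InverseMFerromagnet.PartialCovarianceLadder
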